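import Summits.FinalStateConjecture.FinalStateConjecture.Theorems.PhotonSphereChannelsTameHullDefs
import Literature.Geometry.Lorentzian.SpacetimeKretschmannScalar
import Literature.Geometry.Lorentzian.CoordCurvatureNormSq
import Literature.Geometry.Lorentzian.CausalityOpennessProofs
import HarnessLib

/-!
# Route PhotonSphereChannels · crux `ChannelsResolveTameDevelopmentsR` (K2R-T2, stmt-FinalStateConjecture-17430) —
# the Kretschmann scalar is continuous on a spacetime; the horizon of an end lies in the closed d.o.c.

Two small pieces of point-set bookkeeping for the based hulls of line `dark-future-exactness`
(horizon-hull elements are based at points `p ∈ E.horizon`, while the Kerr / curvature information of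
the rigidity conclusions lives on the OPEN domain of outer communications `E.doc`):

* `continuous_kretschmannAt` — `p ↦ |Rm|²_𝓢(p)` is continuous (near `p₀` it is the smooth coordinate
  function `rmNormSqAt ((c₀⁻¹)^* g)` of `CoordCurvatureNormSq` read through the fixed chart `c₀`, by chart
  independence `rmNormSqAt_metricInCoords_eq_kretschmannAt`); hence bounds on `|Rm|²` over a set pass to
  its closure (`kretschmannAt_le_of_mem_closure`, `le_kretschmannAt_of_mem_closure`);
* `horizon_subset_closure_doc` — for every end datum, `E.horizon = ∂I⁻(far) ∩ I⁺(far) ⊆ closure E.doc`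
  (`I⁺(far)` is open, O'Neill Lemma 14.3, `isOpen_chronologicalFuture_of_boundaryless`).

All results proved; no definitions.

## References

* B. O'Neill, *Semi-Riemannian geometry* (1983), Ch. 3, Prop. 3.59; Ch. 14, Lemma 14.3. [ONeill1983]
* R. M. Wald, *General Relativity* (1984), §12.1. [Wald1984]
-/

noncomputable section

set_option maxSynthPendingDepth 3
set_option linter.dupNamespace false

open Set Filter Function TopologicalSpace Metric
open scoped Topology Manifold ContDiff ENNReal NNReal

namespace Summit.FinalStateConjecture.FinalStateConjecture.Theorems.HullCurvature

open Literature.Geometry.Lorentzian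
open Summit.FinalStateConjecture.FinalStateConjecture.Theorems.TameHull

/-! ## §1 Continuity of the Kretschmann scalar -/

/-- **The Kretschmann scalar of a spacetime is continuous.** Near `p₀`, read through the FIXED preferred
chart `c₀` at `p₀`: `|Rm|²_𝓢(p) = rmNormSqAt ((c₀⁻¹)^* g) (c₀ p)` for `p ∈ c₀.source` (chart independence),
and the coordinate function is `C^∞` on `c₀.target` (`IsMetricOn.contDiffOn_rmNormSqAt`).
[cite: ONeill1983, Ch. 3, Prop. 3.59] -/
theorem continuous_kretschmannAt (𝓢 : Spacetime.{0} 4) : Continuous 𝓢.kretschmannAt := by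
  rw [continuous_iff_continuousAt]
  intro p₀
  have hGm := 𝓢.isMetricOn_metricInCoords_chartAt_symm p₀
  have hsrc : (chartAt E4 p₀).source ∈ 𝓝 p₀ :=
    (chartAt E4 p₀).open_source.mem_nhds (mem_chart_source E4 p₀)
  -- on the chart source the scalar is the coordinate function through the chart
  have heq : ∀ p ∈ (chartAt E4 p₀).source, 𝓢.kretschmannAt p =
      MetricCoord.rmNormSqAt (𝓢.metricInCoords (chartAt E4 p₀).symm) (chartAt E4 p₀ p) := by
    intro p hp
    have hy : chartAt E4 p₀ p ∈ (chartAt E4 p₀).target := (chartAt E4 p₀).map_source hp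
    have h := 𝓢.rmNormSqAt_metricInCoords_eq_kretschmannAt (chartAt E4 p₀).open_target
      (contMDiffOn_chart_symm (x := p₀)) hy (hGm.isInvertible _ hy)
    rw [(chartAt E4 p₀).left_inv hp] at h
    exact h.symm
  have hcont : ContinuousOn (fun p ↦ MetricCoord.rmNormSqAt (𝓢.metricInCoords (chartAt E4 p₀).symm)
      (chartAt E4 p₀ p)) (chartAt E4 p₀).source :=
    hGm.contDiffOn_rmNormSqAt.continuousOn.comp (chartAt E4 p₀).continuousOn_toFun
      fun p hp ↦ (chartAt E4 p₀).map_source hp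
  have hcont' : ContinuousOn 𝓢.kretschmannAt (chartAt E4 p₀).source :=
    hcont.congr fun p hp ↦ heq p hp
  exact hcont'.continuousAt hsrc

/-- **Upper bounds on `|Rm|²` over a set pass to its closure.** [folklore] -/
theorem kretschmannAt_le_of_mem_closure {𝓢 : Spacetime.{0} 4} {O : Set 𝓢.carrier} {b : ℝ}
    (h : ∀ y ∈ O, 𝓢.kretschmannAt y ≤ b) {p : 𝓢.carrier} (hp : p ∈ closure O) :
    𝓢.kretschmannAt p ≤ b := by
  have hclosed : IsClosed {q : 𝓢.carrier | 𝓢.kretschmannAt q ≤ b} :=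
    isClosed_le (continuous_kretschmannAt 𝓢) continuous_const
  exact closure_minimal (fun y hy ↦ h y hy) hclosed hp

/-- **Lower bounds on `|Rm|²` over a set pass to its closure.** [folklore] -/
theorem le_kretschmannAt_of_mem_closure {𝓢 : Spacetime.{0} 4} {O : Set 𝓢.carrier} {b : ℝ}
    (h : ∀ y ∈ O, b ≤ 𝓢.kretschmannAt y) {p : 𝓢.carrier} (hp : p ∈ closure O) :
    b ≤ 𝓢.kretschmannAt p := by
  have hclosed : IsClosed {q : 𝓢.carrier | b ≤ 𝓢.kretschmannAt q} :=
    isClosed_le continuous_const (continuous_kretschmannAt 𝓢)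
  exact closure_minimal (fun y hy ↦ h y hy) hclosed hp

/-! ## §2 The horizon of an end lies in the closed domain of outer communications -/

/-- **`E.horizon ⊆ closure E.doc`** for every end datum: `E.horizon = ∂I⁻(far) ∩ I⁺(far)` and
`E.doc = I⁺(far) ∩ I⁻(far)` with `I⁺(far)` OPEN (O'Neill Lemma 14.3), and an open set meets the closure of
`A` inside the closure of its intersection with `A`. So the base point of a horizon-hull element is a limit
of points of the d.o.c. (where the rigidity conclusions `IsKerrDoc 𝓢 E.doc M a` hold). [cite: Wald1984, §12.1] -/
theorem horizon_subset_closure_doc {𝓢 : Spacetime.{0} 4} (E : EndDatum 𝓢) : E.horizon ⊆ closure E.doc := by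
  intro p hp
  obtain ⟨hfr, hfut⟩ := hp
  have hopen : IsOpen (𝓢.metric.chronologicalFuture 𝓢.timeOrientation (Set.range E.far)) :=
    LorentzianMetric.isOpen_chronologicalFuture_of_boundaryless 𝓢.metric 𝓢.timeOrientation (Set.range E.far)
  have hcl : p ∈ closure (𝓢.metric.chronologicalPast 𝓢.timeOrientation (Set.range E.far)) :=
    frontier_subset_closure hfr
  exact hopen.inter_closure ⟨hfut, hcl⟩

/-- **Summary (registered sub-goal).** The Kretschmann scalar is continuous; bounds over a set pass to
its closure; the horizon of every end lies in its closed d.o.c. [cite: ONeill1983, Ch. 3, Prop. 3.59] -/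
theorem kretschmann_continuity_summary : (∀ 𝓢 : Spacetime.{0} 4, Continuous 𝓢.kretschmannAt) ∧ (∀ {𝓢 : Spacetime.{0} 4} {O : Set 𝓢.carrier} {b : ℝ}, (∀ y ∈ O, 𝓢.kretschmannAt y ≤ b) → ∀ p ∈ closure O, 𝓢.kretschmannAt p ≤ b) ∧ ∀ {𝓢 : Spacetime.{0} 4} (E : EndDatum 𝓢), E.horizon ⊆ closure E.doc :=
  ⟨continuous_kretschmannAt, fun h _ hp ↦ kretschmannAt_le_of_mem_closure h hp,
    fun E ↦ horizon_subset_closure_doc E⟩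

end Summit.FinalStateConjecture.FinalStateConjecture.Theorems.HullCurvature

end
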